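import Literature.IUT.HodgeArakelov.LabelClassesOfCuspsHomogeneousCount
import HarnessLib

/-!
# [IUTchII] Def 2.3 (v): FAITHFULNESS of the conjugation action on `LabCusp^±(Π̂^±_v)` — input (iv) of the `𝔽^±_l`-torsor criterion,
# as group theory for a homogeneous cuspidal datum

S. Mochizuki, *Inter-universal Teichmüller theory II*, kurims manuscript (Dec. 2020), §2 Def 2.3 (v) p. 69 («the natural action of
`Π_⊇/Π_⊆` on `Π_⊆` preserves this `𝔽^±_l`-torsor structure, hence determines a natural outer isomorphism `Π_⊇/Π_⊆ ≅ 𝔽_l^{⋊±}`» — in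
particular the action of `Π̂^cor_v/Π̂^±_v` on the `l` label classes is FAITHFUL) [claim: Mochizuki2012, status: disputed]
(IUTchII §2 Def 2.3 (v), kurims p.69) (D-0012 claim key; record-only; nothing printed is asserted here).

abc-iut cell, seat abc-iut-w5-d132 (gen 6), row «DEF23V-CARD-L», sequel to `LabelClassesOfCuspsHomogeneousCount` (p447018): input (iv)
«an element fixing every `±`-label class by conjugation lies in `Π̂^±_v`» of abc-iut-w5-d243's criterion
`FlTorsorStructureConj.nonempty_iff_conjStable_card_ker` (p440082).  PROOF-ONLY, PURE GROUP THEORY over abc-iut-L6-t1's interface: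

* `conjStable_of_homogeneous` — a homogeneous hatted datum (cusps of `Π̂^±_v` = the `Π̂^cor_v`-conjugates of `J₀`) satisfies law (a);
* `conjClass_mk_conj_smul` — the descended action on the class of a conjugate: `g · ⟦q J₀ q⁻¹⟧ = ⟦(g q) J₀ (g q)⁻¹⟧`;
* `mem_pmHat_or_of_mem_sup` — with the inputs of `card_labCuspPM_eq_l_of_inputs` (separation `N(J₀) ∩ Π̂_X ≤ D`, an inversion `q₁ ∉ Π̂_X`
  normalising `D`), the stabiliser `N(D) · Π̂^±_v` of `⟦J₀⟧` is `Π̂^±_v ∪ q₁ Π̂^±_v`;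
* **`mem_pmHat_of_forall_conjClass_eq`** — if moreover some `z` has `q₁⁻¹ z⁻¹ q₁ z ∉ Π̂^±_v` (the inversion does NOT commute with `z`
  modulo `Π̂^±_v`: in print, `ι` acts by `−1` on `Z = Gal(Y/X)`, so `Π̂^cor_v/Π̂^±_v ≅ 𝔽_l ⋊ {±1}` is dihedral, not abelian), then every
  `g ∈ Π̂^cor_v` fixing all label classes lies in `Π̂^±_v` — (iv).  Proof: `g` fixes `⟦q J₀ q⁻¹⟧` iff `q⁻¹ g⁻¹ q ∈ N(D)·Π̂^±_v`; `q = 1` puts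
  `g` in `Π̂^±_v ∪ q₁Π̂^±_v`; if `g = q₁ π` then `q = z` forces `q₁⁻¹ z⁻¹ q₁ z ∈ Π̂^±_v`.

HONEST LABEL: kernel theorems about the typed interface; the inputs are explicit binders discharged / named at the genuine tower in the
companion `FlTorsorStructureConjGenuine.lean`.  No side taken on [IUTchIII] Cor 3.12; typed ≠ proved; nothing here asserts abc.
-/

noncomputable section

open scoped Pointwise

namespace Literature.IUT.HodgeArakelov

universe u

variable {S : BadPlaceSetting.{u}} {P : TopGroup.{u}} {T : TemperedCoverings S P} {W : PlusMinusTower T}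
variable {C : CuspidalInertiaData W} {J₀ : Subgroup W.Corhat}

/-- **Homogeneity ⇒ law (a)**: if the cusps of `Π̂^±_v` are exactly the `Π̂^cor_v`-conjugates of `J₀`, they are permuted by
`Π̂^cor_v`-conjugation (`ConjStable`). [claim: Mochizuki2012, status: disputed] (IUTchII §2 Rmk 2.3.1, kurims p.69) -/
theorem conjStable_of_homogeneous (hC : ∀ J, C.IsCuspidalInertia W.pmHat J ↔ ∃ q : W.Corhat, J = MulAut.conj q • J₀) :
    C.ConjStable := by
  rw [CuspidalInertiaData.conjStable_iff_smul]
  intro g I hI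
  rw [hC] at hI ⊢
  obtain ⟨q, rfl⟩ := hI
  exact ⟨g * q, by rw [map_mul, mul_smul]⟩

/-- The descended conjugation action on the class of a conjugate of `J₀`: `g · ⟦q J₀ q⁻¹⟧ = ⟦(g q) J₀ (g q)⁻¹⟧`.
[claim: Mochizuki2012, status: disputed] (IUTchII §2 Def 2.3 (v), kurims p.69) -/
theorem conjClass_mk_conj_smul (hCS : C.ConjStable) (g q : W.Corhat)
    (hq : C.IsCuspidalInertia W.pmHat (MulAut.conj q • J₀)) (hgq : C.IsCuspidalInertia W.pmHat (MulAut.conj (g * q) • J₀)) :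
    hCS.conjClass g (Quot.mk _ ⟨MulAut.conj q • J₀, hq⟩) = Quot.mk _ ⟨MulAut.conj (g * q) • J₀, hgq⟩ := by
  rw [CuspidalInertiaData.ConjStable.conjClass_mk]
  refine congrArg (Quot.mk _) (Subtype.ext ?_)
  change (MulAut.conj q • J₀).map (MulAut.conj g).toMonoidHom = MulAut.conj (g * q) • J₀
  rw [← conj_smul_eq_map_conj, ← mul_smul, ← map_mul]

/-- **The stabiliser `N(D) · Π̂^±_v` is `Π̂^±_v ∪ q₁ Π̂^±_v`**: with `Π̂_X` of index `2` containing `Π̂^±_v`, `D ≤ Π̂^±_v` normalising `J₀`,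
separation `N(J₀) ∩ Π̂_X ≤ D`, `J₀` stable under `N(D)`, and an inversion `q₁ ∉ Π̂_X` normalising `D`: every element of `N(D) · Π̂^±_v`
lies in `Π̂^±_v` or in `q₁ Π̂^±_v`. [claim: Mochizuki2012, status: disputed] (IUTchII §2 Def 2.3 (v), kurims p.69) -/
theorem mem_pmHat_or_of_mem_sup {Xh D : Subgroup W.Corhat} (hXh : Xh.index = 2) (hDP : D ≤ W.pmHat)
    (hsep : Subgroup.normalizer (J₀ : Set W.Corhat) ⊓ Xh ≤ D)
    (hJD : ∀ q : W.Corhat, MulAut.conj q • D = D → MulAut.conj q • J₀ = J₀)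
    {q₁ : W.Corhat} (hq₁X : q₁ ∉ Xh) (hq₁D : MulAut.conj q₁ • D = D) {x : W.Corhat}
    (hx : x ∈ Subgroup.normalizer (D : Set W.Corhat) ⊔ W.pmHat) : x ∈ W.pmHat ∨ q₁⁻¹ * x ∈ W.pmHat := by
  set N₂ : Subgroup W.Corhat := Subgroup.normalizer (D : Set W.Corhat) with hN₂
  -- `N(D) ∩ Π̂_X ≤ Π̂^±_v`
  have hN₂X : N₂ ⊓ Xh ≤ W.pmHat := by
    rintro q ⟨hqD, hqX⟩
    have hqJ : MulAut.conj q • J₀ = J₀ := hJD q (mem_normalizer_iff_conj_smul_eq.mp hqD)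
    exact hDP (hsep ⟨mem_normalizer_iff_conj_smul_eq.mpr hqJ, hqX⟩)
  have hq₁N : q₁ ∈ N₂ := mem_normalizer_iff_conj_smul_eq.mpr hq₁D
  rw [mem_sup_normal_iff] at hx
  obtain ⟨p, hp, n, hn, rfl⟩ := hx
  by_cases hnX : n ∈ Xh
  · exact Or.inl (W.pmHat.mul_mem hp (hN₂X ⟨hn, hnX⟩))
  · right
    have h2 : q₁⁻¹ * n ∈ Xh := by
      rw [Subgroup.mul_mem_iff_of_index_two hXh, Subgroup.inv_mem_iff]
      exact ⟨fun h => absurd h hq₁X, fun h => absurd h hnX⟩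
    have hrw : q₁⁻¹ * (p * n) = q₁⁻¹ * p * q₁⁻¹⁻¹ * (q₁⁻¹ * n) := by group
    rw [hrw]
    exact W.pmHat.mul_mem (W.pmHat_normal.conj_mem p hp q₁⁻¹) (hN₂X ⟨N₂.mul_mem (N₂.inv_mem hq₁N) hn, h2⟩)

/-- **INPUT (iv) OF THE Def 2.3 (v) CRITERION — faithfulness — from its group-theoretic inputs.**  Homogeneous hatted datum (cusps of
`Π̂^±_v` = the `Π̂^cor_v`-conjugates of `J₀ ≤ Π̂^±_v`), `Π̂_X` of index `2` containing `Π̂^±_v`, `D ≤ Π̂^±_v` normalising `J₀`, separation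
`N(J₀) ∩ Π̂_X ≤ D`, `J₀` stable under `N(D)`, an inversion `q₁ ∉ Π̂_X` normalising `D`, and an element `z` with `q₁⁻¹ z⁻¹ q₁ z ∉ Π̂^±_v` (the
quotient `Π̂^cor_v/Π̂^±_v` is NOT abelian: the inversion acts by `−1` on `Z`).  Then every `g ∈ Π̂^cor_v` fixing every `±`-label class by
conjugation lies in `Π̂^±_v`. [claim: Mochizuki2012, status: disputed] (IUTchII §2 Def 2.3 (v), kurims p.69) -/
theorem mem_pmHat_of_forall_conjClass_eq (hJ₀ : J₀ ≤ W.pmHat)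
    (hC : ∀ J, C.IsCuspidalInertia W.pmHat J ↔ ∃ q : W.Corhat, J = MulAut.conj q • J₀) (hCS : C.ConjStable)
    {Xh D : Subgroup W.Corhat} (hXh : Xh.index = 2) (hPX : W.pmHat ≤ Xh) (hDP : D ≤ W.pmHat)
    (hDJ : D ≤ Subgroup.normalizer (J₀ : Set W.Corhat)) (hsep : Subgroup.normalizer (J₀ : Set W.Corhat) ⊓ Xh ≤ D)
    (hJD : ∀ q : W.Corhat, MulAut.conj q • D = D → MulAut.conj q • J₀ = J₀)
    {q₁ : W.Corhat} (hq₁X : q₁ ∉ Xh) (hq₁D : MulAut.conj q₁ • D = D)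
    {z : W.Corhat} (hcomm : q₁⁻¹ * z⁻¹ * q₁ * z ∉ W.pmHat)
    {g : W.Corhat} (hg : ∀ t, hCS.conjClass g t = t) : g ∈ W.pmHat := by
  -- `N(J₀) ∩ Π̂^±_v = D`
  have hN₀ : Subgroup.normalizer (J₀ : Set W.Corhat) ⊓ W.pmHat = D :=
    le_antisymm ((inf_le_inf_left _ hPX).trans hsep) (le_inf hDJ hDP)
  have hcusp : ∀ q : W.Corhat, C.IsCuspidalInertia W.pmHat (MulAut.conj q • J₀) := fun q => (hC _).mpr ⟨q, rfl⟩
  -- `g` fixes `⟦q J₀ q⁻¹⟧` iff `(g q)⁻¹ q ∈ N(D) · Π̂^±_v`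
  have hstab : ∀ q : W.Corhat, (g * q)⁻¹ * q ∈ Subgroup.normalizer (D : Set W.Corhat) ⊔ W.pmHat := by
    intro q
    have h := hg (Quot.mk _ ⟨MulAut.conj q • J₀, hcusp q⟩)
    rw [conjClass_mk_conj_smul hCS g q (hcusp q) (hcusp (g * q))] at h
    have h' := (labelRel_conj_smul_iff hJ₀ (hcusp _) (hcusp _)).mp ((labCuspPM_mk_eq_mk_iff C W.pmHat W.pmHat _ _).mp h)
    rwa [hN₀] at h'
  -- `q = 1`: `g ∈ N(D) · Π̂^±_v = Π̂^±_v ∪ q₁ Π̂^±_v`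
  have hg1 : g ∈ Subgroup.normalizer (D : Set W.Corhat) ⊔ W.pmHat := by
    have h := hstab 1
    rw [mul_one, mul_one, Subgroup.inv_mem_iff] at h
    exact h
  rcases mem_pmHat_or_of_mem_sup hXh hDP hsep hJD hq₁X hq₁D hg1 with hgP | hgP
  · exact hgP
  · -- `g = q₁ π`, `π ∈ Π̂^±_v`; test against `q = z`
    exfalso
    have hz : z⁻¹ * g * z ∈ Subgroup.normalizer (D : Set W.Corhat) ⊔ W.pmHat := by
      have h := Subgroup.inv_mem _ (hstab z)
      rwa [show ((g * z)⁻¹ * z)⁻¹ = z⁻¹ * g * z by group] at h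
    rcases mem_pmHat_or_of_mem_sup hXh hDP hsep hJD hq₁X hq₁D hz with h1 | h1
    · -- `z⁻¹ g z ∈ Π̂^±_v` ⇒ `g ∈ Π̂^±_v` ⇒ `q₁ ∈ Π̂^±_v ⊆ Π̂_X`
      have hgP' : g ∈ W.pmHat := by
        have h := W.pmHat_normal.conj_mem _ h1 z
        rwa [show z * (z⁻¹ * g * z) * z⁻¹ = g by group] at h
      apply hq₁X
      apply hPX
      rw [show q₁ = g * (q₁⁻¹ * g)⁻¹ by group]
      exact W.pmHat.mul_mem hgP' (W.pmHat.inv_mem hgP)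
    · -- `q₁⁻¹ z⁻¹ g z ∈ Π̂^±_v` with `g = q₁ π` ⇒ `q₁⁻¹ z⁻¹ q₁ z ∈ Π̂^±_v`
      apply hcomm
      have hπz : z⁻¹ * (q₁⁻¹ * g) * z ∈ W.pmHat := by
        have h := W.pmHat_normal.conj_mem _ hgP z⁻¹
        rwa [inv_inv] at h
      rw [show q₁⁻¹ * z⁻¹ * q₁ * z = q₁⁻¹ * (z⁻¹ * g * z) * (z⁻¹ * (q₁⁻¹ * g) * z)⁻¹ by group]
      exact W.pmHat.mul_mem h1 (W.pmHat.inv_mem hπz)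

end Literature.IUT.HodgeArakelov

end
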